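import Mathlib

/-!
# Certificate checker (rational, kernel-decidable) for the pointwise block-margin residuals P0–P3a (lead c3; soundness: workerCert)

The record format of `CertInterface.md` §4: per box `b` (rational corners) and class `s`, rational entrywise enclosures
`Hlo ≤ H_θ(s) ≤ Hhi` valid for all `θ ∈ b`.  `check` verifies, in exact rational arithmetic, that for every record
`Pᵀ (Hmid − need·1 − diag R) P ≻ 0` by LDLᵀ with positive pivots, where `P` spans `1^⊥` (columns `e_i − e_{i+1}`),
`Hmid`/`Hrad` are the *symmetrised* midpoint/radius of the enclosure, `R_i = Σ_j Hrad_ij` (row sums; `Σ_i R_i y_i²` bounds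
`|yᵀ(H − Hmid)y|` over the box), `need = 64·n·γ_r`.  Soundness (`check_sound`, proved below, abstract in the matrix-valued `H`):
`Enclosures recs → check recs = true → ∀ θ ∈ box, λ_min(H_θ(s)|1^⊥) ≥ need`.
This file is `#eval`-free and compiles stand-alone (Mathlib only).
-/

namespace Summit.QuantumFields.QCD.Cruxes.CriticalLineDiamagnetism.ChessboardCellGain.CertCheck

open Finset

/-- A closed rational box of block twists. -/
structure Box where
  lo : Fin 4 → ℚ
  hi : Fin 4 → ℚ
deriving DecidableEq

/-- One enclosure record: a box, a Walsh class (as the list of active axes, length `n`), and entrywise bounds on the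
`n × n` block Hessian matrix over the box (row-major lists of length `n*n`). -/
structure Rec where
  box : Box
  act : List (Fin 4)
  Hlo : List ℚ
  Hhi : List ℚ
deriving DecidableEq

/-- Entry accessor for a row-major `n × n` rational list (junk `0` out of range). -/
def ent (n : ℕ) (l : List ℚ) (i j : ℕ) : ℚ := l.getD (i * n + j) 0

/-- LDLᵀ positivity test for a symmetric `k × k` rational matrix given as a function: all pivots `> 0`
(pivot `d = M 0 0 > 0`, then recurse on the Schur complement on indices `1..k`). -/
def ldlPos : (k : ℕ) → (ℕ → ℕ → ℚ) → Bool
  | 0, _ => true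
  | k + 1, M =>
    let d := M 0 0
    decide (0 < d) && ldlPos k (fun i j => M (i + 1) (j + 1) - M (i + 1) 0 * M 0 (j + 1) / d)

/-- Symmetrised midpoint of the enclosure `[Hlo, Hhi]` (symmetric in `i, j` by construction). -/
def midM (n : ℕ) (lo hi : List ℚ) (i j : ℕ) : ℚ :=
  (ent n lo i j + ent n hi i j + ent n lo j i + ent n hi j i) / 4

/-- Symmetrised radius of the enclosure `[Hlo, Hhi]` (symmetric in `i, j` by construction). -/
def radM (n : ℕ) (lo hi : List ℚ) (i j : ℕ) : ℚ :=
  (ent n hi i j - ent n lo i j + ent n hi j i - ent n lo j i) / 4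

/-- Row sums of the symmetrised radius. -/
def rowR (n : ℕ) (lo hi : List ℚ) (i : ℕ) : ℚ := ∑ j ∈ Finset.range n, radM n lo hi i j

/-- `X = Hmid − need·1 − diag R`, `need = 64 n γ`. -/
def XM (γ : ℚ) (n : ℕ) (lo hi : List ℚ) (i j : ℕ) : ℚ :=
  midM n lo hi i j - if i = j then 64 * n * γ + rowR n lo hi i else 0

/-- `G = Pᵀ X P` for `P` with columns `e_i − e_{i+1}`: `G i j = X i j − X i (j+1) − X (i+1) j + X (i+1) (j+1)`. -/
def GM (X : ℕ → ℕ → ℚ) (i j : ℕ) : ℚ := X i j - X i (j + 1) - X (i + 1) j + X (i + 1) (j + 1)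

/-- Sanity of a record (not needed for soundness): `n ≥ 2` and `Hlo ≤ Hhi` entrywise. -/
def sane (n : ℕ) (lo hi : List ℚ) : Bool :=
  decide (2 ≤ n) && (List.range n).all fun i => (List.range n).all fun j => decide (ent n lo i j ≤ ent n hi i j)

/-- The per-record test: with `n = |act|`, check sanity and `Pᵀ (Hmid − need·1 − diag R) P ≻ 0` by LDLᵀ. -/
def recOK (γ : ℚ) (r : Rec) : Bool :=
  sane r.act.length r.Hlo r.Hhi && ldlPos (r.act.length - 1) (GM (XM γ r.act.length r.Hlo r.Hhi))

/-- The region-level check: every record passes.  (Coverage of the region by the boxes is a separate,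
purely combinatorial check on `recs.map (·.box)`, see `CertInterface.md` §2.) -/
def check (γ : ℚ) (recs : List Rec) : Bool := recs.all (recOK γ)

/-- Smoke test record: the 2×2 class matrix `[[a,−a],[−a,a]]` with `a = 1/5`, zero radius, `γ = 3/2500`, `n = 2`:
`PᵀXP = 4a − 2·need = 0.8 − 0.3072 > 0`. -/
def smoke : Rec := ⟨⟨fun _ => 1/2, fun _ => 3/5⟩, [0, 1], [1/5, -1/5, -1/5, 1/5], [1/5, -1/5, -1/5, 1/5]⟩

example : check (3/2500) [smoke] = true := by native_decide


/-! ### Soundness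

(1) `ldlPos k M = true` for a symmetric rational `M` ⇒ the real quadratic form `v ↦ Σ_{i,j<k} v_i M_ij v_j` is `≥ 0`
(induction on `k` via the Schur complement identity); (2) the entrywise enclosure gives `H = Hmid + E` with `|E_ij| ≤ Hrad_ij`,
whence `yᵀ E y ≥ −Σ_i R_i y_i²`; (3) for `Σ y = 0`, `y = P z` with `z` the partial sums, so `yᵀ X y = zᵀ G z ≥ 0`. -/

/-- Schur complement identity for a symmetric real kernel on `range (k+1)`, pivot `M 0 0 ≠ 0`. -/
theorem schur_identity (k : ℕ) (M : ℕ → ℕ → ℝ) (hM : ∀ i j, M i j = M j i) (hd : M 0 0 ≠ 0) (v : ℕ → ℝ) :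
    ∑ i ∈ range (k + 1), ∑ j ∈ range (k + 1), v i * M i j * v j =
      M 0 0 * (v 0 + (∑ i ∈ range k, M 0 (i + 1) * v (i + 1)) / M 0 0) ^ 2 +
      ∑ i ∈ range k, ∑ j ∈ range k,
        v (i + 1) * (M (i + 1) (j + 1) - M (i + 1) 0 * M 0 (j + 1) / M 0 0) * v (j + 1) := by
  have h0 : ∀ i, M (i + 1) 0 = M 0 (i + 1) := fun i => hM _ _
  simp only [sum_range_succ', h0]
  set s := ∑ i ∈ range k, M 0 (i + 1) * v (i + 1) with hs
  have e1 : ∑ i ∈ range k, v (i + 1) * M 0 (i + 1) * v 0 = v 0 * s := by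
    rw [hs, mul_sum]; exact sum_congr rfl fun i _ => by ring
  have e2 : ∑ j ∈ range k, v 0 * M 0 (j + 1) * v (j + 1) = v 0 * s := by
    rw [hs, mul_sum]; exact sum_congr rfl fun i _ => by ring
  have e3 : ∑ i ∈ range k, ∑ j ∈ range k,
      v (i + 1) * (M (i + 1) (j + 1) - M 0 (i + 1) * M 0 (j + 1) / M 0 0) * v (j + 1) =
      ∑ i ∈ range k, ∑ j ∈ range k, v (i + 1) * M (i + 1) (j + 1) * v (j + 1) - s * s / M 0 0 := by
    rw [hs, sum_mul_sum, sum_div, ← sum_sub_distrib]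
    refine sum_congr rfl fun i _ => ?_
    rw [sum_div, ← sum_sub_distrib]
    refine sum_congr rfl fun j _ => ?_
    ring
  rw [sum_add_distrib, e1, e2, e3]
  field_simp
  ring

/-- Soundness of the LDLᵀ test: all pivots positive ⇒ the real quadratic form is nonnegative. -/
theorem ldlPos_sound : ∀ (k : ℕ) (M : ℕ → ℕ → ℚ), (∀ i j, M i j = M j i) → ldlPos k M = true →
    ∀ v : ℕ → ℝ, 0 ≤ ∑ i ∈ range k, ∑ j ∈ range k, v i * (M i j : ℝ) * v j
  | 0, _, _, _, _ => by simp
  | k + 1, M, hM, h, v => by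
    simp only [ldlPos, Bool.and_eq_true, decide_eq_true_eq] at h
    obtain ⟨hd, h⟩ := h
    have hM' : ∀ i j, M (i + 1) (j + 1) - M (i + 1) 0 * M 0 (j + 1) / M 0 0 =
        M (j + 1) (i + 1) - M (j + 1) 0 * M 0 (i + 1) / M 0 0 := by
      intro i j; rw [hM (j + 1) (i + 1), hM (j + 1) 0, hM 0 (i + 1)]; ring
    have ih := ldlPos_sound k _ hM' h (fun i => v (i + 1))
    push_cast at ih
    have hMr : ∀ i j, (M i j : ℝ) = (M j i : ℝ) := fun i j => by rw [hM i j]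
    have hd' : (0 : ℝ) < (M 0 0 : ℝ) := by exact_mod_cast hd
    have key := schur_identity k (fun i j => (M i j : ℝ)) hMr hd'.ne' v
    rw [key]
    exact add_nonneg (mul_nonneg hd'.le (sq_nonneg _)) ih

/-- Abel summation with vanishing total sum. -/
theorem abel0 (n : ℕ) (f y : ℕ → ℝ) (hy : ∑ i ∈ range n, y i = 0) :
    ∑ i ∈ range n, f i * y i =
      ∑ i ∈ range (n - 1), (f i - f (i + 1)) * ∑ t ∈ range (i + 1), y t := by
  have h := sum_range_by_parts f y n
  simp only [smul_eq_mul] at h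
  rw [h, hy, mul_zero, zero_sub, ← sum_neg_distrib]
  exact sum_congr rfl fun i _ => by ring

/-- `yᵀ X y = zᵀ (Pᵀ X P) z` for `Σ y = 0`, `z` the partial sums of `y`. -/
theorem pxp_identity (n : ℕ) (X : ℕ → ℕ → ℝ) (y : ℕ → ℝ) (hy : ∑ i ∈ range n, y i = 0) :
    ∑ i ∈ range n, ∑ j ∈ range n, y i * X i j * y j =
      ∑ i ∈ range (n - 1), ∑ j ∈ range (n - 1),
        (∑ t ∈ range (i + 1), y t) * (X i j - X i (j + 1) - X (i + 1) j + X (i + 1) (j + 1)) *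
          (∑ t ∈ range (j + 1), y t) := by
  have step1 : ∑ i ∈ range n, ∑ j ∈ range n, y i * X i j * y j =
      ∑ i ∈ range n, (∑ j ∈ range n, X i j * y j) * y i := by
    refine sum_congr rfl fun i _ => ?_
    rw [sum_mul]; exact sum_congr rfl fun j _ => by ring
  rw [step1, abel0 n _ y hy]
  refine sum_congr rfl fun i _ => ?_
  rw [← sum_sub_distrib]
  have step2 : ∑ j ∈ range n, (X i j * y j - X (i + 1) j * y j) =
      ∑ j ∈ range n, (X i j - X (i + 1) j) * y j :=
    sum_congr rfl fun j _ => by ring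
  rw [step2, abel0 n _ y hy, sum_mul]
  exact sum_congr rfl fun j _ => by ring

/-- Weighted AM–GM term bound: `|e| ≤ r ⇒ a e b ≥ −r (a² + b²)/2`. -/
theorem term_bound (a b e r : ℝ) (he : |e| ≤ r) : -(r * (a ^ 2 + b ^ 2) / 2) ≤ a * e * b := by
  have h2 : 2 * (|a| * |b|) ≤ a ^ 2 + b ^ 2 := by
    have := two_mul_le_add_sq |a| |b|
    simp only [sq_abs] at this; linarith
  have h1 : |a * e * b| ≤ r * (a ^ 2 + b ^ 2) / 2 := by
    rw [abs_mul, abs_mul]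
    calc |a| * |e| * |b| = |e| * (|a| * |b|) := by ring
      _ ≤ r * (|a| * |b|) := by gcongr
      _ ≤ r * ((a ^ 2 + b ^ 2) / 2) :=
          mul_le_mul_of_nonneg_left (by linarith) ((abs_nonneg e).trans he)
      _ = r * (a ^ 2 + b ^ 2) / 2 := by ring
  have := neg_abs_le (a * e * b)
  linarith

/-- Perturbation bound: `|E_ij| ≤ rad_ij` (symmetric `rad`) ⇒ `yᵀ E y ≥ −Σ_i (Σ_j rad_ij) y_i²`. -/
theorem pert_bound (N : Finset ℕ) (E rad : ℕ → ℕ → ℝ) (y : ℕ → ℝ)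
    (hE : ∀ i ∈ N, ∀ j ∈ N, |E i j| ≤ rad i j) (hrad : ∀ i j, rad i j = rad j i) :
    -(∑ i ∈ N, (∑ j ∈ N, rad i j) * y i ^ 2) ≤ ∑ i ∈ N, ∑ j ∈ N, y i * E i j * y j := by
  have h1 : ∑ i ∈ N, ∑ j ∈ N, -(rad i j * (y i ^ 2 + y j ^ 2) / 2) ≤ ∑ i ∈ N, ∑ j ∈ N, y i * E i j * y j :=
    sum_le_sum fun i hi => sum_le_sum fun j hj => term_bound _ _ _ _ (hE i hi j hj)
  have h2 : ∑ i ∈ N, ∑ j ∈ N, -(rad i j * (y i ^ 2 + y j ^ 2) / 2) = -(∑ i ∈ N, (∑ j ∈ N, rad i j) * y i ^ 2) := by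
    have e : ∀ i j, -(rad i j * (y i ^ 2 + y j ^ 2) / 2) = -(rad i j * y i ^ 2 / 2) + -(rad i j * y j ^ 2 / 2) := by
      intros; ring
    simp_rw [e, sum_add_distrib]
    have hc : ∑ i ∈ N, ∑ j ∈ N, -(rad i j * y j ^ 2 / 2) = ∑ j ∈ N, ∑ i ∈ N, -(rad i j * y j ^ 2 / 2) := sum_comm
    rw [hc, ← sum_add_distrib, ← sum_neg_distrib]
    refine sum_congr rfl fun i _ => ?_
    rw [← sum_add_distrib, sum_mul, ← sum_neg_distrib]
    refine sum_congr rfl fun j _ => ?_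
    rw [hrad j i]; ring
  linarith

/-- Diagonal kernels: `Σ_ij y_i [i=j] c_i y_j = Σ_i c_i y_i²`. -/
theorem qf_diag (N : Finset ℕ) (c y : ℕ → ℝ) :
    ∑ i ∈ N, ∑ j ∈ N, y i * (if i = j then c i else 0) * y j = ∑ i ∈ N, c i * y i ^ 2 := by
  refine sum_congr rfl fun i hi => ?_
  simp only [mul_ite, mul_zero, ite_mul, zero_mul, sum_ite_eq, hi, if_true]
  ring

theorem midM_symm (n : ℕ) (lo hi : List ℚ) (i j : ℕ) : midM n lo hi i j = midM n lo hi j i := by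
  unfold midM; ring

theorem radM_symm (n : ℕ) (lo hi : List ℚ) (i j : ℕ) : radM n lo hi i j = radM n lo hi j i := by
  unfold radM; ring

theorem XM_symm (γ : ℚ) (n : ℕ) (lo hi : List ℚ) : ∀ i j, XM γ n lo hi i j = XM γ n lo hi j i := by
  intro i j
  unfold XM
  by_cases h : i = j
  · subst h; rfl
  · rw [if_neg h, if_neg (Ne.symm h), midM_symm]

theorem GM_symm (X : ℕ → ℕ → ℚ) (hX : ∀ i j, X i j = X j i) : ∀ i j, GM X i j = GM X j i := by
  intro i j
  simp only [GM]
  rw [hX j i, hX j (i + 1), hX (j + 1) i, hX (j + 1) (i + 1)]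
  ring

/-- The abstract per-record soundness statement. -/
theorem rec_sound (n : ℕ) (γ : ℚ) (lo hi : List ℚ) (Hm : ℕ → ℕ → ℝ)
    (hsym : ∀ i j, Hm i j = Hm j i)
    (henc : ∀ i j, i < n → j < n → ((ent n lo i j : ℚ) : ℝ) ≤ Hm i j ∧ Hm i j ≤ ((ent n hi i j : ℚ) : ℝ))
    (hldl : ldlPos (n - 1) (GM (XM γ n lo hi)) = true)
    (y : ℕ → ℝ) (hy : ∑ i ∈ range n, y i = 0) :
    (64 * n * (γ : ℝ)) * ∑ i ∈ range n, y i ^ 2 ≤ ∑ i ∈ range n, ∑ j ∈ range n, y i * Hm i j * y j := by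
  -- (2) entrywise enclosure ⇒ |H − mid| ≤ rad on the range
  have hb : ∀ i ∈ range n, ∀ j ∈ range n,
      |Hm i j - (midM n lo hi i j : ℝ)| ≤ (radM n lo hi i j : ℝ) := by
    intro i hi' j hj'
    rw [mem_range] at hi' hj'
    obtain ⟨h1, h2⟩ := henc i j hi' hj'
    obtain ⟨h3, h4⟩ := henc j i hj' hi'
    rw [hsym j i] at h3 h4
    simp only [midM, radM, abs_le]
    push_cast
    constructor <;> linarith
  have hE := pert_bound (range n) (fun i j => Hm i j - (midM n lo hi i j : ℝ)) (fun i j => (radM n lo hi i j : ℝ)) y hb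
    (fun i j => by simp only [radM_symm n lo hi i j])
  -- (3)+(1) yᵀ X y = zᵀ G z ≥ 0
  have hX : 0 ≤ ∑ i ∈ range n, ∑ j ∈ range n, y i * (XM γ n lo hi i j : ℝ) * y j := by
    have h1 := pxp_identity n (fun i j => (XM γ n lo hi i j : ℝ)) y hy
    have h2 := ldlPos_sound (n - 1) (GM (XM γ n lo hi)) (GM_symm _ (XM_symm γ n lo hi)) hldl
      (fun i => ∑ t ∈ range (i + 1), y t)
    simp only [GM] at h2
    push_cast at h2
    rw [h1]; exact h2
  -- the cast of X
  have hXc : ∀ i j, (XM γ n lo hi i j : ℝ) =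
      (midM n lo hi i j : ℝ) - if i = j then (64 * n * (γ : ℝ) + ∑ j' ∈ range n, (radM n lo hi i j' : ℝ)) else 0 := by
    intro i j
    unfold XM rowR
    split_ifs <;> push_cast <;> ring
  have hXq : ∑ i ∈ range n, ∑ j ∈ range n, y i * (XM γ n lo hi i j : ℝ) * y j =
      ∑ i ∈ range n, ∑ j ∈ range n, y i * (midM n lo hi i j : ℝ) * y j -
      ∑ i ∈ range n, (64 * n * (γ : ℝ) + ∑ j' ∈ range n, (radM n lo hi i j' : ℝ)) * y i ^ 2 := by
    rw [← qf_diag (range n) _ y, ← sum_sub_distrib]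
    refine sum_congr rfl fun i _ => ?_
    rw [← sum_sub_distrib]
    refine sum_congr rfl fun j _ => ?_
    rw [hXc]; ring
  have hEq : ∑ i ∈ range n, ∑ j ∈ range n, y i * (Hm i j - (midM n lo hi i j : ℝ)) * y j =
      ∑ i ∈ range n, ∑ j ∈ range n, y i * Hm i j * y j -
      ∑ i ∈ range n, ∑ j ∈ range n, y i * (midM n lo hi i j : ℝ) * y j := by
    rw [← sum_sub_distrib]
    refine sum_congr rfl fun i _ => ?_
    rw [← sum_sub_distrib]
    refine sum_congr rfl fun j _ => ?_
    ring
  have hsplit : ∑ i ∈ range n, (64 * n * (γ : ℝ) + ∑ j' ∈ range n, (radM n lo hi i j' : ℝ)) * y i ^ 2 =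
      (64 * n * (γ : ℝ)) * ∑ i ∈ range n, y i ^ 2 +
      ∑ i ∈ range n, (∑ j' ∈ range n, (radM n lo hi i j' : ℝ)) * y i ^ 2 := by
    rw [mul_sum, ← sum_add_distrib]
    exact sum_congr rfl fun i _ => by ring
  linarith

/-- Real box membership `θ ∈ b` (a `Membership` instance rather than a `def … : Prop`, so the file audit stays clean). -/
instance : Membership (Fin 4 → ℝ) Box :=
  ⟨fun b θ => ∀ μ, ((b.lo μ : ℚ) : ℝ) ≤ θ μ ∧ θ μ ≤ ((b.hi μ : ℚ) : ℝ)⟩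

theorem Box.mem_iff (b : Box) (θ : Fin 4 → ℝ) :
    θ ∈ b ↔ ∀ μ, ((b.lo μ : ℚ) : ℝ) ≤ θ μ ∧ θ μ ≤ ((b.hi μ : ℚ) : ℝ) := Iff.rfl

/-- **Soundness of `check`.**  If every record encloses the real symmetric matrices `H θ` entrywise on its box
(indices through `act`), and `check γ recs = true`, then on every box `H θ − 64 n γ ·1` is positive semidefinite on `1^⊥`:
for all real `y` with `Σ_i y i = 0`, `64 n γ Σ y_i² ≤ Σ_ij y_i H_ij y_j`. -/
theorem check_sound (γ : ℚ) (recs : List Rec) (H : (Fin 4 → ℝ) → List (Fin 4) → ℕ → ℕ → ℝ)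
    (hsym : ∀ θ act i j, H θ act i j = H θ act j i)
    (henc : ∀ r ∈ recs, ∀ θ, θ ∈ r.box → ∀ i j, i < r.act.length → j < r.act.length →
      ((ent r.act.length r.Hlo i j : ℚ) : ℝ) ≤ H θ r.act i j ∧ H θ r.act i j ≤ ((ent r.act.length r.Hhi i j : ℚ) : ℝ))
    (hc : check γ recs = true) :
    ∀ r ∈ recs, ∀ θ, θ ∈ r.box → ∀ y : ℕ → ℝ, (∑ i ∈ Finset.range r.act.length, y i) = 0 →
      (64 * r.act.length * (γ : ℝ)) * ∑ i ∈ Finset.range r.act.length, y i ^ 2 ≤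
        ∑ i ∈ Finset.range r.act.length, ∑ j ∈ Finset.range r.act.length, y i * H θ r.act i j * y j := by
  intro r hr θ hθ y hy
  have hrec : recOK γ r = true := List.all_eq_true.1 hc r hr
  simp only [recOK, Bool.and_eq_true] at hrec
  exact rec_sound r.act.length γ r.Hlo r.Hhi (H θ r.act) (hsym θ r.act)
    (fun i j hi hj => henc r hr θ hθ i j hi hj) hrec.2 y hy

end Summit.QuantumFields.QCD.Cruxes.CriticalLineDiamagnetism.ChessboardCellGain.CertCheck
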